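import Mathlib.Geometry.Manifold.IntegralCurve.Basic
import Mathlib.Analysis.Calculus.Deriv.MeanValue
import Literature.Geometry.Lorentzian.CauchyDevelopment
import HarnessLib

/-!
# Eventually red-shifted event horizons (surface gravity of a dynamical horizon bounded below)

Vocabulary for the red-shift input of the final-state routes (definition request
`defn-HasEventuallyRedShiftedHorizon`, route TwoBoundarySqueeze, card
two-boundary-squeeze-observability-lojasiewicz B5): the event horizon of a late charted region
of a Cauchy development, and the predicate "its surface gravity is eventually bounded below by a
positive constant", the hypothesis under which the Dafermos–Rodnianski red-shift vector field
exists (Dafermos–Rodnianski, *Lectures on black holes and linear waves*, arXiv:0811.0354,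
§3.3.2, Prop. 3.3.1 and §7.1, Thm. 7.1: "Suppose `κ > 0`. Then there exists a `φ_t`-invariant
future-directed timelike vector field `N` … such that `K^N ≥ b J^N_μ N^μ`" near the horizon; the
construction "depends only on the positivity of" the surface gravity, p. 18), and which fails on
degenerate (extremal, `κ = 0`) horizons (Aretakis, arXiv:1206.6598).

## Main definitions (namespace `Literature.Geometry.Lorentzian`)

* `LorentzianMetric.HasSurfaceGravityGe g τ 𝓗 t κ₀` — for a time-oriented `C^n` Lorentzian
  manifold, a subset `𝓗 ⊆ M` (meant: a late piece of a future event horizon), a clock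
  `t : M → ℝ` and `κ₀ : ℝ`: there is a vector field `L`, `C^n` near `𝓗`, which on `𝓗` is
  future-directed null, normalised by `dt(L) = 1`, whose integral curves starting on `𝓗` stay
  on `𝓗` (so that `L` spans the null generators of `𝓗`), and which is pregeodesic with
  non-affinity `∇_L L = κ L`, `κ ≥ κ₀` on `𝓗`. For a Killing horizon with Killing generator
  `V` and a clock with `V t = 1` this `L` is `V` and `κ` is the surface gravity of
  `∇_V V = κ V` (Dafermos–Rodnianski 2008, p. 19 and §7.1; Wald 1984, (12.5.2)); `κ₀ > 0` is
  exactly the hypothesis of Dafermos–Rodnianski's Thm. 7.1.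
* `CauchyDevelopment.eventHorizonOf 𝒟 U = ∂I⁻(U) ∩ J⁺(ι X)` — the future event horizon of
  the region `U` (meant: the charted late region of a final-state decomposition / an
  asymptotically stationary exhaustion), the analogue of
  `LorentzianMetric.futureEventHorizonOfEnd` (`Stationary.lean`, `∂I⁻(M_ext) ∩ I⁺(M_ext)`) with
  the asymptotic region replaced by `U` and the stationary `I⁺(M_ext)` replaced by the causal
  future of the data hypersurface, matching `exteriorOf 𝒟 U = J⁺(ι X) ∩ I⁻(U)` of the
  final-state statement.
* `CauchyDevelopment.HasEventuallyRedShiftedHorizon 𝒟 U t` — there are `κ₀ > 0` and a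
  threshold `t₁` such that the late horizon `eventHorizonOf 𝒟 U ∩ {t ≥ t₁}` has surface gravity
  `≥ κ₀` with respect to the clock `t`, uniformly (one `κ₀` for all later times).

## Main results (all proved)

* `HasSurfaceGravityGe.of_le` (monotone in `κ₀`), `hasSurfaceGravityGe_empty` (documented
  vacuity: an empty horizon is red-shifted), `HasSurfaceGravityGe.inter_setOf_le` (a horizon
  red-shifted after `t₁` is red-shifted after every `t₂ ≥ t₁`: the clock increases along the
  generators, `dt(L) = 1`, by the chain rule and the mean value theorem);
* `CauchyDevelopment.eventHorizonOf_empty`, `eventHorizonOf_subset_causalFuture`,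
  `disjoint_eventHorizonOf_chronologicalPast` (the horizon does not meet `I⁻(U)`, hence not the
  exterior region `J⁺(ι X) ∩ I⁻(U)`, given openness of chronological pasts);
* `CauchyDevelopment.hasEventuallyRedShiftedHorizon_iff`,
  `HasEventuallyRedShiftedHorizon.of_eventHorizonOf_eq_empty` (no horizon ⇒ trivially
  red-shifted: dispersing developments), `HasEventuallyRedShiftedHorizon.eventually` (the
  threshold may be taken arbitrarily late).

## Design choices

* **Why a clock `t` is part of the signature.** The surface gravity of a null hypersurface
  which is *not* a Killing horizon is defined only relative to a normalisation of its null
  generator: if `∇_L L = κ L` then `L' = f L` has `∇_{L'} L' = (f κ + L f) L'`, so along one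
  generator any `κ` (e.g. `κ' = 0`, affine parametrisation; or `κ' ≡ 1`) can be arranged by
  reparametrisation (Wald 1984, §12.5, discussion of (12.5.2): `κ` is fixed by normalising the
  Killing field at infinity). For a stationary black hole the normalisation is "`L` is the
  Killing generator", i.e. `L t = 1` for the Killing time `t`; for a dynamical black hole
  settling down to Kerr it is `L t* = 1` for the time function `t*` of the late-time charts in
  which the metric converges (the advanced-time foliation of Dafermos–Holzegel–Rodnianski–Taylor
  and Klainerman–Szeftel). The pair (development, late region `U`) determines the horizon but no
  such clock, and an existential quantifier over clocks would be vacuous (with the clock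
  `κ₀⁻¹ log v`, `v` affine, even an extremal horizon has "surface gravity `κ₀`"). Hence the
  clock is an explicit argument; it also gives "late" (`{t ≥ t₁}`) and "uniformly at all late
  times" their meaning. Users supply the time function of their asymptotically stationary
  exhaustion, extended across the horizon; only its germ at the late horizon matters.
* **Why the generator form and not the `N`-multiplier form.** Dafermos–Rodnianski's red-shift
  vector field `N` (timelike, `K^N[ψ] ≥ b J^N_μ[ψ] N^μ` on the horizon) is the *conclusion* of
  their Thm. 7.1 from the hypothesis `κ > 0` formalised here; as a definition it would again need
  a normalisation (`N` is `φ_t`-invariant there; without it a time-dependent boost of any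
  timelike field achieves the coercivity inequality along a degenerate horizon too), and the
  deformation tensor `K^N` is not yet in the prelude (`EnergyCurrents.lean`, "left to a
  sequel"). Vendoring Thm. 7.1 itself as a named fact is left to a cite item.
* Tangency of `L` to `𝓗` is phrased, as in `LorentzianMetric.IsNonDegenerateHorizon`
  (`Stationary.lean`), through integral curves, here *forward* in the parameter and for curve
  segments (`IsMIntegralCurveOn γ L (Icc a b)`): the late horizon is forward invariant under the
  flow of `L`. No smooth structure on `𝓗` is presupposed; `L` is an ambient vector field,
  required `C^n` on a neighbourhood of `𝓗` only.
* Regularity and dimension hypotheses of the Levi-Civita API (`[Fact (1 ≤ n)]`,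
  `[FiniteDimensional ℝ E]`, `[CompleteSpace E]`, `[g.HasLeviCivita]`) are section instances of
  the general predicate, as for `IsNonDegenerateHorizon`; the `CauchyDevelopment` predicate binds
  `[𝒟.metric.HasLeviCivita]` innermost (the pattern of `HasCompleteNullInfinity` in the
  final-state statement; it is discharged by `PseudoRiemannianMetric.hasLeviCivita`).
* Vacuity, documented: if the (late) horizon is empty the predicates hold (`L = 0`); this is
  intended — a development without black holes has nothing to red-shift — and, as for
  `IsNonDegenerateHorizon`, "there is a black hole" must be asserted separately. A clock bounded
  above on the horizon likewise makes the late horizon empty; the clock is meant to tend to `+∞`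
  along the generators.

## What is not here

The Kerr instance (sub-extremal Kerr–star `t*`: `κ = (r₊ − r₋)/(2(r₊² + a²)) > 0`; extremal:
`κ = 0`, Dafermos–Rodnianski 2008, §5.1–5.2, Aretakis 2012), Dafermos–Rodnianski's Thm. 7.1 as a
named fact, and the `N`-multiplier / deformation-tensor vocabulary.

## References

* M. Dafermos, I. Rodnianski, *Lectures on black holes and linear waves*, Clay Math. Proc. 17
  (2013), arXiv:0811.0354: §3.3.1–3.3.2 (pp. 18–19 of the held text: Prop. 3.3.1, the
  characterisation `∇_T T = κ T` of the surface gravity), §7.1, Thm. 7.1 (p. 43)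
  (key `DafermosRodnianski2008`).
* M. Dafermos, I. Rodnianski, *The red-shift effect and radiation decay on black hole
  spacetimes*, CPAM 62 (2009), arXiv:gr-qc/0512119.
* S. Aretakis, *Horizon instability of extremal black holes*, arXiv:1206.6598.
* M. Dafermos, I. Rodnianski, Y. Shlapentokh-Rothman, arXiv:1402.7034, §1.1.4.
* R. M. Wald, *General Relativity*, Chicago 1984, §12.5, (12.5.2)–(12.5.4) (key `Wald1984`).
* S. W. Hawking, G. F. R. Ellis, *The large scale structure of space-time*, CUP 1973, §9.2
  (event horizon `∂I⁻`), key `HawkingEllis1973`.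
-/

noncomputable section

open Bundle Set Manifold
open scoped ContDiff Topology Manifold

universe u

namespace Literature.Geometry.Lorentzian

section General

variable {E : Type*} [NormedAddCommGroup E] [NormedSpace ℝ E] {H : Type*} [TopologicalSpace H]
  {I : ModelWithCorners ℝ E H} {M : Type*} [TopologicalSpace M] [ChartedSpace H M]
  [IsManifold I ∞ M] {n : ℕ∞ω}

namespace LorentzianMetric

variable (g : LorentzianMetric I n M) (τ : TimeOrientation g)
variable [g.HasLeviCivita]

/-- **Surface gravity bounded below by `κ₀` on `𝓗`, with respect to the clock `t`** (the
hypothesis of the red-shift construction). For a time-oriented `C^n` Lorentzian manifold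
`(M, g, τ)`, a subset `𝓗 ⊆ M` (meant: a late piece of a future event horizon, a null
hypersurface), a function `t : M → ℝ` (the clock: an asymptotically stationary time function,
e.g. Kerr–star time `t*` or advanced time `v`, extended across the horizon) and `κ₀ : ℝ`:
there are a vector field `L` and a function `κ` such that

* `L` is `C^n` (as a section of `TM`) on an open neighbourhood of `𝓗`;
* at every `p ∈ 𝓗`: `L p` is null and future-directed, `dt_p(L p) = 1` (clock normalisation),
  `∇_{L p} L = κ(p) L p` (`L` is pregeodesic; `κ` is its non-affinity = the surface gravity in
  the normalisation `t`) and `κ₀ ≤ κ(p)`;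
* `𝓗` is forward invariant under the flow of `L`: an integral curve of `L` on `[a, b]` which
  starts on `𝓗` ends on `𝓗` (so `L` is tangent to `𝓗` and its integral curves are the null
  generators, reparametrised by the clock).

For a Killing horizon with Killing generator `V` and a clock with `V t = 1` one has `L = V` on
`𝓗` and `κ` is the surface gravity `∇_V V = κ V` (Dafermos–Rodnianski, arXiv:0811.0354, p. 19
and §7.1; Wald 1984, (12.5.2)); "`κ > 0`" is the hypothesis of Dafermos–Rodnianski's red-shift
theorem, Thm. 7.1. The value of `κ` depends on the clock (`t ↦ c t` rescales it by `c⁻¹`; the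
affine clock gives `κ = 0`), see the module docstring. *Vacuity:* holds for `𝓗 = ∅`
(`hasSurfaceGravityGe_empty`). Standing hypothesis `[g.HasLeviCivita]`.
[cite: DafermosRodnianski2008, §7.1 Thm. 7.1 and §3.3.2 Prop. 3.3.1] -/
def HasSurfaceGravityGe (𝓗 : Set M) (t : M → ℝ) (κ₀ : ℝ) : Prop :=
  ∃ (L : Π x : M, TangentSpace I x) (κ : M → ℝ),
    (∃ 𝒩 : Set M, IsOpen 𝒩 ∧ 𝓗 ⊆ 𝒩 ∧ CMDiff[𝒩] n (T% L)) ∧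
    (∀ p ∈ 𝓗, g.IsNull (L p) ∧ τ.IsFutureDirected (L p) ∧ mvfderiv I t p (L p) = 1 ∧
      g.leviCivita L p (L p) = κ p • L p ∧ κ₀ ≤ κ p) ∧
    ∀ (γ : ℝ → M) (a b : ℝ), a ≤ b → IsMIntegralCurveOn γ L (Icc a b) → γ a ∈ 𝓗 → γ b ∈ 𝓗

variable {g τ}

/-- Unfolding lemma for `HasSurfaceGravityGe`. [folklore] -/
lemma hasSurfaceGravityGe_iff {𝓗 : Set M} {t : M → ℝ} {κ₀ : ℝ} :
    g.HasSurfaceGravityGe τ 𝓗 t κ₀ ↔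
      ∃ (L : Π x : M, TangentSpace I x) (κ : M → ℝ),
        (∃ 𝒩 : Set M, IsOpen 𝒩 ∧ 𝓗 ⊆ 𝒩 ∧ CMDiff[𝒩] n (T% L)) ∧
        (∀ p ∈ 𝓗, g.IsNull (L p) ∧ τ.IsFutureDirected (L p) ∧ mvfderiv I t p (L p) = 1 ∧
          g.leviCivita L p (L p) = κ p • L p ∧ κ₀ ≤ κ p) ∧
        ∀ (γ : ℝ → M) (a b : ℝ), a ≤ b → IsMIntegralCurveOn γ L (Icc a b) →
          γ a ∈ 𝓗 → γ b ∈ 𝓗 :=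
  Iff.rfl

/-- Surface gravity `≥ κ₀` implies surface gravity `≥ κ₁` for `κ₁ ≤ κ₀` (same generator field).
Dafermos–Rodnianski, arXiv:0811.0354, §7.1. [folklore] -/
lemma HasSurfaceGravityGe.of_le {𝓗 : Set M} {t : M → ℝ} {κ₀ κ₁ : ℝ}
    (h : g.HasSurfaceGravityGe τ 𝓗 t κ₀) (hκ : κ₁ ≤ κ₀) : g.HasSurfaceGravityGe τ 𝓗 t κ₁ := by
  obtain ⟨L, κ, hreg, hpt, hinv⟩ := h
  refine ⟨L, κ, hreg, fun p hp ↦ ?_, hinv⟩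
  obtain ⟨h1, h2, h3, h4, h5⟩ := hpt p hp
  exact ⟨h1, h2, h3, h4, hκ.trans h5⟩

/-- *Documented vacuity:* the empty set has surface gravity `≥ κ₀` for every clock and every
`κ₀` (take `L = 0` on the empty neighbourhood) — a spacetime without a black hole has nothing to
red-shift; compare the warning at `LorentzianMetric.IsNonDegenerateHorizon`. [folklore] -/
lemma hasSurfaceGravityGe_empty (t : M → ℝ) (κ₀ : ℝ) :
    g.HasSurfaceGravityGe τ (∅ : Set M) t κ₀ :=
  ⟨0, 0, ⟨∅, isOpen_empty, Subset.rfl, fun _ h ↦ h.elim⟩, fun _ h ↦ h.elim,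
    fun _ _ _ _ _ h ↦ h.elim⟩

-- `TangentSpace 𝓘(ℝ, ℝ) s` is definitionally `ℝ`; reading the manifold derivative of the real function
-- `t ∘ γ` as an ordinary derivative moves across this identification, exactly as Mathlib's
-- `IsMIntegralCurveOn.hasDerivWithinAt` does (same option, same proof pattern).
set_option backward.isDefEq.respectTransparency false in
omit [IsManifold I ∞ M] [g.HasLeviCivita] in
/-- **The clock increases at unit rate along the generators.** If `γ` is an integral curve of
`L` on `[a, b]` all of whose points lie in a set on which `dt(L) = 1`, then `t ∘ γ` is monotone
on `[a, b]` (chain rule: `(t ∘ γ)' = dt(L) = 1`, and the mean value theorem). Elementary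
calculus; used for `HasSurfaceGravityGe.inter_setOf_le`. [folklore] -/
lemma monotoneOn_comp_of_isMIntegralCurveOn {L : Π x : M, TangentSpace I x} {t : M → ℝ}
    {S : Set M} (hS : ∀ p ∈ S, mvfderiv I t p (L p) = 1) {γ : ℝ → M} {a b : ℝ}
    (hγ : IsMIntegralCurveOn γ L (Icc a b)) (hmem : ∀ s ∈ Icc a b, γ s ∈ S) :
    MonotoneOn (t ∘ γ) (Icc a b) := by
  -- the derivative of `t ∘ γ` within `[a, b]` at every `s ∈ [a, b]` is `dt(L (γ s)) = 1`
  have hderiv : ∀ s ∈ Icc a b, HasDerivWithinAt (t ∘ γ) 1 (Icc a b) s := by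
    intro s hs
    have h1 : mvfderiv I t (γ s) (L (γ s)) = 1 := hS _ (hmem s hs)
    -- `t` is differentiable at `γ s` (otherwise `mvfderiv = 0 ≠ 1`)
    have ht : MDiffAt t (γ s) := by
      by_contra hnd
      have h0 : mfderiv% t (γ s) = 0 := mfderiv_zero_of_not_mdifferentiableAt hnd
      have : mvfderiv I t (γ s) (L (γ s)) = 0 := by simp [mvfderiv, h0]
      rw [this] at h1
      exact zero_ne_one h1
    rw [hasDerivWithinAt_iff_hasFDerivWithinAt, ← hasMFDerivWithinAt_iff_hasFDerivWithinAt]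
    apply (ht.hasMFDerivAt.comp_hasMFDerivWithinAt s (hγ s hs)).congr_mfderiv
    rw [ContinuousLinearMap.ext_iff]
    intro r
    have h1' : mfderiv% t (γ s) (L (γ s)) = (1 : ℝ) := h1
    rw [ContinuousLinearMap.comp_apply, ContinuousLinearMap.smulRight_apply, map_smul, h1']
    rfl
  refine monotoneOn_of_hasDerivWithinAt_nonneg (convex_Icc a b)
    (fun s hs ↦ (hderiv s hs).continuousWithinAt) (fun s hs ↦ ?_) fun _ _ ↦ zero_le_one
  exact ((hderiv s (interior_subset hs)).mono interior_subset)

/-- **Later thresholds.** If `𝓗 ∩ {t ≥ t₁}` has surface gravity `≥ κ₀` with respect to the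
clock `t`, then so does `𝓗 ∩ {t ≥ t₂}` for every `t₂ ≥ t₁`, with the same generator field: the
only point is forward invariance of the smaller set, which holds because the clock increases
along the generators (`dt(L) = 1`, `monotoneOn_comp_of_isMIntegralCurveOn`). Hence "eventually
red-shifted" may be read "red-shifted after every sufficiently late time"
(`CauchyDevelopment.HasEventuallyRedShiftedHorizon.eventually`). [folklore] -/
theorem HasSurfaceGravityGe.inter_setOf_le {𝓗 : Set M} {t : M → ℝ} {κ₀ t₁ t₂ : ℝ}
    (h : g.HasSurfaceGravityGe τ (𝓗 ∩ {p | t₁ ≤ t p}) t κ₀) (h₁₂ : t₁ ≤ t₂) :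
    g.HasSurfaceGravityGe τ (𝓗 ∩ {p | t₂ ≤ t p}) t κ₀ := by
  obtain ⟨L, κ, ⟨𝒩, h𝒩, hsub, hL⟩, hpt, hinv⟩ := h
  have hsub' : 𝓗 ∩ {p | t₂ ≤ t p} ⊆ 𝓗 ∩ {p | t₁ ≤ t p} :=
    fun p hp ↦ ⟨hp.1, h₁₂.trans hp.2⟩
  refine ⟨L, κ, ⟨𝒩, h𝒩, hsub'.trans hsub, hL⟩, fun p hp ↦ hpt p (hsub' hp), ?_⟩
  intro γ a b hab hγ ha
  -- every point of the segment lies on the `t₁`-late horizon (invariance on `[a, s]`)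
  have hmem : ∀ s ∈ Icc a b, γ s ∈ 𝓗 ∩ {p | t₁ ≤ t p} := fun s hs ↦
    hinv γ a s hs.1 (hγ.mono (Icc_subset_Icc_right hs.2)) (hsub' ha)
  refine ⟨(hmem b (right_mem_Icc.mpr hab)).1, ?_⟩
  -- and the clock does not decrease along it
  have hmono := monotoneOn_comp_of_isMIntegralCurveOn (fun p hp ↦ (hpt p hp).2.2.1) hγ hmem
  have hle : t (γ a) ≤ t (γ b) :=
    hmono (left_mem_Icc.mpr hab) (right_mem_Icc.mpr hab) hab
  exact ha.2.trans hle

/-- A set with surface gravity `≥ κ₀` carries, at each of its points, a future-directed null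
vector `L p` normalised by the clock, `dt(L p) = 1`, with `∇_{L p} L = κ L p`, `κ ≥ κ₀`
(projection of the definition). Dafermos–Rodnianski, arXiv:0811.0354, §7.1. [folklore] -/
lemma HasSurfaceGravityGe.exists_generator {𝓗 : Set M} {t : M → ℝ} {κ₀ : ℝ}
    (h : g.HasSurfaceGravityGe τ 𝓗 t κ₀) :
    ∃ L : Π x : M, TangentSpace I x, ∀ p ∈ 𝓗, g.IsNull (L p) ∧ τ.IsFutureDirected (L p) ∧
      mvfderiv I t p (L p) = 1 ∧ ∃ κ : ℝ, κ₀ ≤ κ ∧ g.leviCivita L p (L p) = κ • L p := by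
  obtain ⟨L, κ, -, hpt, -⟩ := h
  refine ⟨L, fun p hp ↦ ?_⟩
  obtain ⟨h1, h2, h3, h4, h5⟩ := hpt p hp
  exact ⟨h1, h2, h3, κ p, h5, h4⟩

end LorentzianMetric

end General

/-! ### The event horizon of a late region of a Cauchy development; eventual red-shift -/

namespace CauchyDevelopment

variable {n : ℕ} {X : Type u} [TopologicalSpace X] [ChartedSpace (EuclideanSpace ℝ (Fin n)) X]
  [IsManifold (𝓡 n) ∞ X] [ConnectedSpace X] {D : InitialDataSet (𝓡 n) X}

/-- The **future event horizon of the region `U`** in the Cauchy development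
`𝒟 = (M, g, τ, ι, ν)`: `𝓗⁺(U) := ∂I⁻(U) ∩ J⁺(ι X)`, the boundary of the past of `U` to the
causal future of the data hypersurface. For `U` the charted late region of a final-state
decomposition (or the asymptotic region of an end) this is the event horizon of the black holes
seen from `U`, the boundary in `J⁺(ι X)` of the exterior region `J⁺(ι X) ∩ I⁻(U)`
(`exteriorOf` of the final-state statement); compare
`LorentzianMetric.futureEventHorizonOfEnd M_ext = ∂I⁻(M_ext) ∩ I⁺(M_ext)` (`Stationary.lean`,
Chruściel–Costa (2.5)). Hawking–Ellis 1973, §9.2 (the event horizon `J̇⁻(𝓘⁺)`); Wald 1984,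
§12.1; Dafermos–Luk, arXiv:1710.01722, Conjecture 1 (b). [cite: HawkingEllis1973, §9.2] -/
def eventHorizonOf (𝒟 : CauchyDevelopment D) (U : Set 𝒟.carrier) : Set 𝒟.carrier :=
  frontier (𝒟.metric.chronologicalPast 𝒟.timeOrientation U) ∩
    𝒟.metric.causalFuture 𝒟.timeOrientation (range 𝒟.embed)

/-- Unfolding lemma for `eventHorizonOf`. [folklore] -/
lemma mem_eventHorizonOf_iff (𝒟 : CauchyDevelopment D) (U : Set 𝒟.carrier) (p : 𝒟.carrier) :
    p ∈ 𝒟.eventHorizonOf U ↔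
      p ∈ frontier (𝒟.metric.chronologicalPast 𝒟.timeOrientation U) ∧
        p ∈ 𝒟.metric.causalFuture 𝒟.timeOrientation (range 𝒟.embed) :=
  Iff.rfl

/-- The event horizon of `U` lies to the causal future of the data hypersurface.
Hawking–Ellis 1973, §9.2. [folklore] -/
lemma eventHorizonOf_subset_causalFuture (𝒟 : CauchyDevelopment D) (U : Set 𝒟.carrier) :
    𝒟.eventHorizonOf U ⊆ 𝒟.metric.causalFuture 𝒟.timeOrientation (range 𝒟.embed) :=
  inter_subset_right

/-- The event horizon of `U` lies in the boundary of `I⁻(U)`. Hawking–Ellis 1973, §9.2.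
[folklore] -/
lemma eventHorizonOf_subset_frontier (𝒟 : CauchyDevelopment D) (U : Set 𝒟.carrier) :
    𝒟.eventHorizonOf U ⊆ frontier (𝒟.metric.chronologicalPast 𝒟.timeOrientation U) :=
  inter_subset_left

/-- No region, no horizon: `𝓗⁺(∅) = ∅` (`I⁻(∅) = ∅`). [folklore] -/
@[simp]
lemma eventHorizonOf_empty (𝒟 : CauchyDevelopment D) : 𝒟.eventHorizonOf ∅ = ∅ := by
  have h : 𝒟.metric.chronologicalPast 𝒟.timeOrientation (∅ : Set 𝒟.carrier) = ∅ := by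
    ext q
    simp [LorentzianMetric.chronologicalPast, LorentzianMetric.mem_chronologicalFuture_iff]
  simp [eventHorizonOf, h]

/-- The event horizon of `U` is disjoint from `I⁻(U)` (an open set does not meet its
frontier; openness of chronological pasts is the hypothesis `hP`, the parametrised predicate
`LorentzianMetric.isOpen_chronologicalPast` of `Causality.lean`, which holds on manifolds without
boundary), hence from the exterior region `J⁺(ι X) ∩ I⁻(U)`. Hawking–Ellis 1973, §9.2;
Chruściel–Costa, Astérisque 321 (2008), §2.2. [folklore] -/
theorem disjoint_eventHorizonOf_chronologicalPast (𝒟 : CauchyDevelopment D)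
    (hP : 𝒟.metric.isOpen_chronologicalPast 𝒟.timeOrientation) (U : Set 𝒟.carrier) :
    Disjoint (𝒟.eventHorizonOf U) (𝒟.metric.chronologicalPast 𝒟.timeOrientation U) := by
  refine Set.disjoint_left.2 fun x hx hx' ↦ ?_
  have hn : (2 : ℕ∞ω) ≤ ∞ := WithTop.coe_le_coe.mpr le_top
  have h := (hP hn U).inter_frontier_eq
  exact (Set.ext_iff.1 h x).1 ⟨hx', hx.1⟩

/-- **The event horizon of `U` is eventually red-shifted with respect to the clock `t`**
(definition request `defn-HasEventuallyRedShiftedHorizon`; the red-shift input of the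
final-state routes): there are a constant `κ₀ > 0` and a threshold `t₁` such that the late
horizon `𝓗⁺(U) ∩ {t ≥ t₁}` has surface gravity `≥ κ₀` with respect to `t`
(`LorentzianMetric.HasSurfaceGravityGe`: a `C^∞` future null generator field `L` of the late
horizon, normalised by `dt(L) = 1`, with `∇_L L = κ L`, `κ ≥ κ₀`), uniformly — one `κ₀` for all
later times (`HasEventuallyRedShiftedHorizon.eventually`). Here `U` is meant to be the charted
late region of a final-state decomposition / asymptotically stationary exhaustion and `t` its
time function (Kerr–star `t*` or advanced time) extended across the horizon; the clock is an
argument because surface gravity of a non-Killing horizon is defined only relative to such a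
normalisation (module docstring). This is the hypothesis "`κ > 0`" of the red-shift theorem of
Dafermos–Rodnianski (arXiv:0811.0354, §7.1, Thm. 7.1; §3.3, Prop. 3.3.1: the construction of
the red-shift vector field `N`, `K^N ≥ b J^N_μ N^μ`, "depends only on the positivity of" the
surface gravity), asked eventually and uniformly along a dynamical horizon; it fails for
degenerate horizons (`κ = 0`: extremal Kerr, Aretakis arXiv:1206.6598; cf.
Dafermos–Rodnianski–Shlapentokh-Rothman arXiv:1402.7034, §1.1.4). *Vacuity:* holds when
`𝓗⁺(U) = ∅` (no black hole; `of_eventHorizonOf_eq_empty`) and when the clock is bounded above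
on the horizon. The standing Levi-Civita hypothesis `[g.HasLeviCivita]` is bound innermost (as
in `HasCompleteNullInfinity`; discharge it with `PseudoRiemannianMetric.hasLeviCivita`).
[cite: DafermosRodnianski2008, §7.1 Thm. 7.1 and §3.3.2 Prop. 3.3.1] -/
def HasEventuallyRedShiftedHorizon (𝒟 : CauchyDevelopment D) (U : Set 𝒟.carrier)
    (t : 𝒟.carrier → ℝ) : Prop :=
  ∀ [𝒟.metric.HasLeviCivita], ∃ κ₀ : ℝ, 0 < κ₀ ∧ ∃ t₁ : ℝ,
    𝒟.metric.HasSurfaceGravityGe 𝒟.timeOrientation (𝒟.eventHorizonOf U ∩ {p | t₁ ≤ t p}) t κ₀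

/-- Unfolding lemma for `HasEventuallyRedShiftedHorizon` under the Levi-Civita instance.
[folklore] -/
lemma hasEventuallyRedShiftedHorizon_iff (𝒟 : CauchyDevelopment D) [𝒟.metric.HasLeviCivita]
    (U : Set 𝒟.carrier) (t : 𝒟.carrier → ℝ) :
    𝒟.HasEventuallyRedShiftedHorizon U t ↔ ∃ κ₀ : ℝ, 0 < κ₀ ∧ ∃ t₁ : ℝ,
      𝒟.metric.HasSurfaceGravityGe 𝒟.timeOrientation
        (𝒟.eventHorizonOf U ∩ {p | t₁ ≤ t p}) t κ₀ :=
  ⟨fun h ↦ h, fun h _ ↦ h⟩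

/-- *Documented vacuity / the dispersive case:* if the region `U` has no event horizon
(`𝓗⁺(U) = ∅`, e.g. a development dispersing to Minkowski space, or `U = ∅`), its horizon is
eventually red-shifted for every clock (with `κ₀ = 1`, say). [folklore] -/
theorem HasEventuallyRedShiftedHorizon.of_eventHorizonOf_eq_empty {𝒟 : CauchyDevelopment D}
    {U : Set 𝒟.carrier} (hU : 𝒟.eventHorizonOf U = ∅) (t : 𝒟.carrier → ℝ) :
    𝒟.HasEventuallyRedShiftedHorizon U t := by
  intro _
  refine ⟨1, one_pos, 0, ?_⟩
  rw [hU, empty_inter]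
  exact LorentzianMetric.hasSurfaceGravityGe_empty t 1

/-- The empty region has an eventually red-shifted (empty) horizon. [folklore] -/
lemma hasEventuallyRedShiftedHorizon_empty (𝒟 : CauchyDevelopment D) (t : 𝒟.carrier → ℝ) :
    𝒟.HasEventuallyRedShiftedHorizon ∅ t :=
  HasEventuallyRedShiftedHorizon.of_eventHorizonOf_eq_empty 𝒟.eventHorizonOf_empty t

/-- **Uniformity in the threshold.** If the horizon of `U` is eventually red-shifted with
respect to `t`, then with one constant `κ₀ > 0` the late horizon `𝓗⁺(U) ∩ {t ≥ t₂}` has surface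
gravity `≥ κ₀` for *every* sufficiently late `t₂` (the clock increases along the generators;
`HasSurfaceGravityGe.inter_setOf_le`). [folklore] -/
theorem HasEventuallyRedShiftedHorizon.eventually {𝒟 : CauchyDevelopment D}
    [𝒟.metric.HasLeviCivita] {U : Set 𝒟.carrier} {t : 𝒟.carrier → ℝ}
    (h : 𝒟.HasEventuallyRedShiftedHorizon U t) :
    ∃ κ₀ : ℝ, 0 < κ₀ ∧ ∃ t₁ : ℝ, ∀ t₂ : ℝ, t₁ ≤ t₂ →
      𝒟.metric.HasSurfaceGravityGe 𝒟.timeOrientation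
        (𝒟.eventHorizonOf U ∩ {p | t₂ ≤ t p}) t κ₀ := by
  obtain ⟨κ₀, hκ₀, t₁, h₁⟩ := h
  exact ⟨κ₀, hκ₀, t₁, fun t₂ h₁₂ ↦ h₁.inter_setOf_le h₁₂⟩

/-- An eventually red-shifted horizon is eventually red-shifted with any smaller positive
constant: the predicate only records `∃ κ₀ > 0` (monotonicity `HasSurfaceGravityGe.of_le`).
[folklore] -/
theorem HasEventuallyRedShiftedHorizon.exists_of_lt {𝒟 : CauchyDevelopment D}
    [𝒟.metric.HasLeviCivita] {U : Set 𝒟.carrier} {t : 𝒟.carrier → ℝ}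
    (h : 𝒟.HasEventuallyRedShiftedHorizon U t) {κ₁ : ℝ} (hκ₁ : 0 < κ₁) :
    ∃ κ₀ : ℝ, 0 < κ₀ ∧ κ₀ ≤ κ₁ ∧ ∃ t₁ : ℝ,
      𝒟.metric.HasSurfaceGravityGe 𝒟.timeOrientation
        (𝒟.eventHorizonOf U ∩ {p | t₁ ≤ t p}) t κ₀ := by
  obtain ⟨κ₀, hκ₀, t₁, h₁⟩ := h
  exact ⟨min κ₀ κ₁, lt_min hκ₀ hκ₁, min_le_right _ _, t₁, h₁.of_le (min_le_left _ _)⟩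

end CauchyDevelopment

end Literature.Geometry.Lorentzian

end
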